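import Literature.Claims.NS.ShlapunovTarkhanov2020
import Literature.Analysis.FluidPDE.ClaySettingParasiticDrift

/-!
# D-0090 NS-CLAIMS — C16 `ShlapunovTarkhanov2020`: kernel refutation of the typed Step 3a

A. Shlapunov, N. Tarkhanov, "Existence theorems for regular solutions to the Cauchy problem for the
Navier–Stokes equations in ℝ³", arXiv:2009.10530 **v2** (2020), withdrawn by the authors in v3
(«A significant gap in the proof has been found»). Skeleton: `Literature.Claims.NS.ShlapunovTarkhanov2020`
(typist-2, p462375).

* `not_Ineq313Inference` — the typed Step 3a `Ineq313Inference` (p. 34 l. 1–9, "energy type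
  inequality (3.10) implies (3.13) … for all positive Q", TeX labels `eq.En.Est.sigma.new` →
  `eq.sol.sigma.4.PQ.0.prime`) is FALSE as an inference between nonnegative reals: (3.10) bounds the
  `2r`-th power `‖u(t)‖^{2r}_{L^{2r}}`, and taking `2r`-th roots turns the coefficient `1/(10²Q)` of the
  solution terms into `(10²Q)^{-1/(2r)}`, which exceeds `1/(10²Q)` whenever `10²Q > 1` — in particular at
  the value `Q = 2` fixed on p. 38. Countermodel (`ineq313Inference_fails_at`, every admissible `r > 3/2`,
  `Q = 2`): `x = 1/6`, `y₁ = 1`, `a = b = c = y₂ = 0`: the hypothesis reads `(1/6)^{2r} ≤ 1/200` (true since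
  `(1/6)^{2r} ≤ (1/6)^3 = 1/216`), the conclusion reads `1/6 ≤ 1/200` (false).
* DOWNSTREAM (F4, «as printed»): `not_Corollary48Uniqueness` — Corollary 4.8 (p. 48) prints uniqueness of
  the pair `(u,p)` in the bare class `C^∞([0,∞)×ℝ³) × C^∞([0,∞)×ℝ³)`; from the zero datum with zero force the
  rest state and the Koch–Nadirashvili–Seregin–Šverák parasitic drift `u = b(t)`, `p = −b′(t)·x` are two
  smooth solutions that differ at every positive time (`Literature.Analysis.FluidPDE.not_unique_claySetting_without_energy`).
  Hence `not_Corollary48` and `not_ClaimedTheorem` for the headline AS TYPED (its uniqueness clause); the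
  paper's Theorem 4.7 states uniqueness inside its weighted Hölder scale, which is not typed and not
  touched here.

Classification (cell vocabulary): Step 3a = false lemma (countermodel) at the abstract grain; it is the
printed justification inside the proof of the load-bearing Step 3 `Theorem31` (p. 29), which is not
decided here.

WHAT THIS IS NOT: not a claim about NS regularity or blow-up; not a claim about any author beyond the
typed locator.
-/

set_option linter.dupNamespace false

noncomputable section

open Literature.Analysis.FluidPDE Literature.Claims.NS.ShlapunovTarkhanov2020
open scoped ContDiff

namespace Summit.NavierStokesRegularity.NavierStokesRegularity.Theorems.ShlapunovTarkhanov2020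

/-- Arithmetic core of the countermodel: `(1/6)^{2r} ≤ 1/200` for every real `r ≥ 3/2`
(indeed `(1/6)^{2r} ≤ (1/6)^3 = 1/216`). [folklore] -/
theorem one_sixth_rpow_le (r : ℝ) (hr : 3 / 2 ≤ r) : (1 / 6 : ℝ) ^ (2 * r) ≤ 1 / 200 := by
  have h3 : (3 : ℝ) ≤ 2 * r := by linarith
  have step : (1 / 6 : ℝ) ^ (2 * r) ≤ (1 / 6 : ℝ) ^ (3 : ℝ) :=
    Real.rpow_le_rpow_of_exponent_ge (by norm_num) (by norm_num) h3
  have h216 : (1 / 6 : ℝ) ^ (3 : ℝ) = 1 / 216 := by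
    rw [show (3 : ℝ) = ((3 : ℕ) : ℝ) by norm_num, Real.rpow_natCast]; norm_num
  linarith [step, h216]

/-- **Countermodel to Step 3a at the value `Q = 2` of p. 38, for every admissible `r > 3/2`**:
`x = 1/6`, `a = b = c = 0`, `y₁ = 1`, `y₂ = 0` satisfy the hypothesis of `Ineq313Inference` at `Q = 2`
(`(1/6)^{2r} ≤ 0 + 0 + 0 + (1/200)·(1 + 0)`) and violate its conclusion (`1/6 ≤ (1/200)·(1 + 0) + 0`).
[cite: ShlapunovTarkhanov2020NSR3Withdrawn, p. 34 l. 1–9, (3.10) ⇒ (3.13); p. 38 (Q = 2)] -/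
theorem ineq313Inference_fails_at (r : ℝ) (hr : 3 / 2 < r) :
    ∃ x a b c y₁ y₂ : ℝ, 0 ≤ x ∧ 0 ≤ a ∧ 0 ≤ b ∧ 0 ≤ c ∧ 0 ≤ y₁ ∧ 0 ≤ y₂ ∧
      x ^ (2 * r) ≤ a ^ (2 * r) + b + c +
          1 / (10 ^ 2 * (2 : ℝ)) * (y₁ ^ (16 * r ^ 2 / (8 * r - 1)) + y₂ ^ (16 * r ^ 2 / (8 * r - 1))) ∧
      ¬ x ≤ 1 / (10 ^ 2 * (2 : ℝ)) * (y₁ ^ (8 * r / (8 * r - 1)) + y₂ ^ (8 * r / (8 * r - 1))) +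
          (a + b ^ (1 / (2 * r)) + c ^ (1 / (2 * r))) := by
  have hr0 : 0 < r := by linarith
  have h2r : (2 * r) ≠ 0 := by positivity
  have h8 : (8 * r - 1) ≠ 0 := by intro h0; linarith
  have e1 : (16 * r ^ 2 / (8 * r - 1)) ≠ 0 := div_ne_zero (by positivity) h8
  have e2 : (8 * r / (8 * r - 1)) ≠ 0 := div_ne_zero (by positivity) h8
  have e3 : (1 / (2 * r)) ≠ 0 := by positivity
  refine ⟨1 / 6, 0, 0, 0, 1, 0, by norm_num, le_rfl, le_rfl, le_rfl, by norm_num, le_rfl, ?_, ?_⟩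
  · rw [Real.zero_rpow h2r, Real.one_rpow, Real.zero_rpow e1]
    have := one_sixth_rpow_le r hr.le
    norm_num at this ⊢
    linarith
  · rw [Real.one_rpow, Real.zero_rpow e2, Real.zero_rpow e3, not_le]
    norm_num

/-- **Step 3a is false**: `¬ Ineq313Inference` (instantiate at `r = 2`, `Q = 2` and use
`ineq313Inference_fails_at`). [cite: ShlapunovTarkhanov2020NSR3Withdrawn, p. 34 l. 1–9] -/
theorem not_Ineq313Inference : ¬ Ineq313Inference := by
  intro h
  obtain ⟨x, a, b, c, y₁, y₂, hx, ha, hb, hc, hy₁, hy₂, hyp, hnot⟩ :=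
    ineq313Inference_fails_at 2 (by norm_num)
  exact hnot (h 2 2 x a b c y₁ y₂ (by norm_num) (by norm_num) hx ha hb hc hy₁ hy₂ hyp)

/-! ### Downstream (F4, as printed): the uniqueness clause of Corollary 4.8 in the bare smooth class -/

/-- The zero force is smooth on the closed half-space `ℝ³ × [0,∞)`. [folklore] -/
theorem isSmoothOnHalfSpace_zero_force :
    IsSmoothOnHalfSpace (0 : ℝ → EuclideanSpace ℝ (Fin 3) → EuclideanSpace ℝ (Fin 3)) := by
  show ContDiffOn ℝ ∞ (fun _ : ℝ × EuclideanSpace ℝ (Fin 3) => (0 : EuclideanSpace ℝ (Fin 3))) _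
  exact contDiffOn_const

/-- The zero force has Fefferman's space-time decay (5) (all its derivatives vanish). [folklore] -/
theorem hasRapidSpaceTimeDecay_zero_force :
    HasRapidSpaceTimeDecay (0 : ℝ → EuclideanSpace ℝ (Fin 3) → EuclideanSpace ℝ (Fin 3)) := by
  intro n K
  refine ⟨0, fun t _ x => ?_⟩
  have : Function.uncurry (0 : ℝ → EuclideanSpace ℝ (Fin 3) → EuclideanSpace ℝ (Fin 3)) =
      fun _ => 0 := by
    funext z; rfl
  rw [this, iteratedFDerivWithin_fun_zero, Pi.zero_apply, norm_zero, mul_zero]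

/-- **Corollary 4.8's uniqueness clause, as printed in the bare class `C^∞ × C^∞`, is false at every
viscosity**: from the zero datum (a Clay datum) with the zero force (a Clay force), the rest state and the
KNSS parasitic drift are two smooth solutions of (4.36) that differ at every `t > 0`.
[cite: KochNadirashviliSereginSverak2009, §1 (arXiv p. 3)]
[cite: ShlapunovTarkhanov2020NSR3Withdrawn, Cor. 4.8 p. 48] -/
theorem not_Corollary48Uniqueness (μ : ℝ) : ¬ Corollary48Uniqueness μ := by
  intro h
  obtain ⟨u₀, u, v, p, q, h1, h2, h3, hu, hus, hps, hv, hvs, hqs, hne⟩ :=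
    not_unique_claySetting_without_energy μ
  have huv := (h u₀ 0 h1 h2 h3 isSmoothOnHalfSpace_zero_force hasRapidSpaceTimeDecay_zero_force
    u v p q hus hps hu hvs hqs hv).1
  exact hne 1 one_pos (by rw [huv])

/-- Hence Corollary 4.8 as printed (existence ∧ uniqueness in `C^∞ × C^∞`) fails at every viscosity —
through its uniqueness clause only; the existence clause `Corollary48Existence` is not touched.
[cite: ShlapunovTarkhanov2020NSR3Withdrawn, Cor. 4.8 p. 48] -/
theorem not_Corollary48 (μ : ℝ) : ¬ Corollary48 μ := fun h => not_Corollary48Uniqueness μ h.2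

/-- And the headline AS TYPED (`∀ μ > 0, Corollary48 μ`) fails, again through the printed uniqueness
clause only. [cite: ShlapunovTarkhanov2020NSR3Withdrawn, Cor. 4.8 p. 48] -/
theorem not_ClaimedTheorem : ¬ ClaimedTheorem := fun h => not_Corollary48 1 (h 1 one_pos)

end Summit.NavierStokesRegularity.NavierStokesRegularity.Theorems.ShlapunovTarkhanov2020

end
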